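import Summits.BirchSwinnertonDyer.BirchSwinnertonDyer.Theorems.SignedLowerHalvesSmallImageLowerHalfBothSignsRttCharRoadE1LocalCoresClass
import Summits.BirchSwinnertonDyer.BirchSwinnertonDyer.Theorems.SignedLowerHalvesSmallImageLowerHalfBothSignsRttCharRoadE1LocalAtPInfty
import Summits.BirchSwinnertonDyer.BirchSwinnertonDyer.Theorems.SignedLowerHalvesSmallImageLowerHalfBothSignsRttCharRoadE1LocalSquareLayer
import Summits.BirchSwinnertonDyer.BirchSwinnertonDyer.Theorems.SignedLowerHalvesSmallImageLowerHalfBothSignsRttCharRoadE1LocalSquareInert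
import Summits.BirchSwinnertonDyer.BirchSwinnertonDyer.Theorems.ThetaPartnerAtTwoSignedMainConjectureCMTwoRankZeroPTDeepTransferTools
import HarnessLib

/-!
# Route `SignedLowerHalves`, crux L `SmallImageLowerHalfBothSigns` (stmt-BirchSwinnertonDyer-23599), line `rtt_w3` v11 — brick D3-W AT `p`, END TO END
# (memo `Lines/rtt_w3-MEMO-D3c-w3g17.md` §8 steps (0)+(2)–(5) composed; k = ℚ, K quadratic, p inert, κ cyclotomic):
# from a `K`-side class over `Γ_{K_n}` in Kobayashi's signed Kummer condition `E^ε(K_n·K_w)` at `closureEmb K_w`, the class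
# `res_{ℚ_∞} cor (e^* subgroupH1Iso y)` over `ℚ_∞` lies in INJ_top's condition above `p`, `AcSigned.condAbove W p κ v₀ (.sgn ε)`.

Width seat `bsd-line-slh-p3-w3` g17 under LEAD `cruxlead-stmt-BirchSwinnertonDyer-23599` (cell `bsd-ssimc`; `--supports stmt-BirchSwinnertonDyer-23599 --as helper`).
THEOREMS ONLY (no definition, no named fact, no instance, no `sorry`); pure composition of `…E1LocalSquareLayer` (group identification),
`EtaLayer.subgroupH1Iso_mem_localKummerOverOfEmb_iff` (cell bsd-potss), `…E1LocalCoresClass` ★★★★ (cor step + hA'tr + descent), `…E1LocalAtPInfty` ★★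
(layer → ∞, all conjugates). The square `(ι, ι₂, hcompat, hι₂, hfixU)` and the transversal `c` are exactly the output of
`…E1LocalSquareInert.exists_localSquare_layers_of_eq_span`; `e` is any iso of `exists_continuousMulEquiv_subgroupOf_inf`; `hN`, `hM`, `hopen` are the
openness/continuity facts the corestriction needs. BSD / crux L / INJ are NOT proved here.

* `isOpen_subgroupOf_galRange`, `continuous_smul_subgroup_geomPrimaryTorsion`, `isOpen_layerSubgroup_inf_galRange` — the openness /
  continuity inputs `hN`, `hM`, `hopen` of the corestriction, discharged (tree: `isOpen_galRange`, `κ.isOpen_layerSubgroup`, `continuous_smul_geomPoints`).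
* ★★★★★ `resOfLe_corH1_mem_condAbove_sgn` — the statement above (with `hN`, `hM`, `hopen` as hypotheses, so that it matches ANY `corH1 hN hM hc` term
  of the glue; by proof irrelevance the discharged versions may be passed).
* ★★★★★ `conjH1_corH1_mem_localKummerOverOfEmb_signed_closureEmb` — the LAYER-`n` handshake with the LEAD's `…RttCharRoadE1TopPackaging.
  resOfLe_mem_acSignedSelmer_of_layer` (its hypothesis `hsgn` at `v₀`): every `Γ_ℚ`-conjugate of `cor (e^* (subgroupH1Iso (res_= y)))` satisfies
  Kobayashi's signed Kummer condition at layer `n` at `closureEmb ℚ_{v₀}` (change of embedding `EtaLayer.conjH1_mem_localKummerOverOfEmb_iff` + all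
  conjugates at the layer `SignedLowerOffTwo.PTDeep.conjH1_mem_localKummerOverOfEmb_signed`).

References: [Kobayashi2003] Def. 1.1; [BDKim2009] §2 p. 185; [BDKim2013] Def. 3.1/3.3; [SerreGaloisCohomology1997] I §2.4, II §1.1;
[NeukirchSchmidtWingberg2008] I §5.
-/

set_option autoImplicit false
set_option linter.dupNamespace false -- D-0017: single-problem summit, the namespace repeats the problem name by design
noncomputable section

open scoped Classical

namespace Summit.BirchSwinnertonDyer.BirchSwinnertonDyer.Theorems.SmallImageCharSignedSelmer

open NumberField IsDedekindDomain Field Literature.NumberTheory.EllipticCurves Literature.NumberTheory.GaloisRepresentations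
  Summit.BirchSwinnertonDyer.Rank1Residual.Additive.LocalTransport Summit.BirchSwinnertonDyer.Rank1Residual.Additive.BaseChange

section Inputs

variable (K : Type) [Field K] [NumberField K] {p : ℕ} [hp : Fact p.Prime] (κ : ZpExtension ℚ p) (W : WeierstrassCurve ℚ) (n : ℕ)

/-- `hN`: `(galRange K) ∩ Γ_{ℚ_n}` is open in `Γ_{ℚ_n}` (`galRange K` is open). [cite: SerreGaloisCohomology1997, I §1.1] -/
theorem isOpen_subgroupOf_galRange :
    IsOpen (((galRange (K := ℚ) K).subgroupOf (κ.layerSubgroup n) : Subgroup (κ.layerSubgroup n)) : Set (κ.layerSubgroup n)) :=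
  (isOpen_galRange (K := ℚ) K).preimage continuous_subtype_val

omit hp in
/-- `hM`: the orbit maps of `E[p^∞]` under a subgroup of `Γ_ℚ` are continuous (`E(ℚ̄)` is a discrete `Γ_ℚ`-module). [cite: SerreGaloisCohomology1997, II §1] -/
theorem continuous_smul_subgroup_geomPrimaryTorsion (H : Subgroup (absoluteGaloisGroup ℚ)) (m : W.geomPrimaryTorsion p) :
    Continuous fun g : H ↦ g • m := by
  have h : Continuous fun g : H ↦ ((g : absoluteGaloisGroup ℚ) • (m : W.geomPoints)) :=
    (W.continuous_smul_geomPoints (m : W.geomPoints)).comp continuous_subtype_val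
  rw [continuous_induced_rng]
  convert h using 1
  funext g
  rw [Function.comp_apply, Subgroup.smul_def, primaryComponent.coe_smul]

/-- `hopen`: `Γ_{ℚ_n} ∩ galRange K` is open in `Γ_ℚ`. [cite: SerreGaloisCohomology1997, I §1.1] -/
theorem isOpen_layerSubgroup_inf_galRange :
    IsOpen ((κ.layerSubgroup n ⊓ galRange (K := ℚ) K : Subgroup (absoluteGaloisGroup ℚ)) : Set (absoluteGaloisGroup ℚ)) :=
  (κ.isOpen_layerSubgroup n).inter (isOpen_galRange (K := ℚ) K)

end Inputs

section Glue

variable (K : Type) [Field K] [NumberField K] (hK2 : Module.finrank ℚ K = 2) {p : ℕ} [hp : Fact p.Prime] (hp2 : p ≠ 2)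
  (κ : ZpExtension ℚ p) (hκ : κ.IsCyclotomic) (v₀ : HeightOneSpectrum (𝓞 ℚ)) (hv₀ : ((p : ℕ) : 𝓞 ℚ) ∈ v₀.asIdeal)
  (w : HeightOneSpectrum (𝓞 K)) [w.asIdeal.LiesOver v₀.asIdeal]
  (ι : AlgebraicClosure ℚ →ₐ[ℚ] AlgebraicClosure (v₀.adicCompletion ℚ))
  (ι₂ : AlgebraicClosure (v₀.adicCompletion ℚ) ≃+* AlgebraicClosure (w.adicCompletion K))
  (hcompat : ∀ z : AlgebraicClosure ℚ, closureEmb (K := K) (w.adicCompletion K) (closureEmb (K := ℚ) K z) = ι₂ (ι z))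
  (hι₂ : ∀ y : v₀.adicCompletion ℚ, ι₂ (algebraMap (v₀.adicCompletion ℚ) (AlgebraicClosure (v₀.adicCompletion ℚ)) y) =
    algebraMap (w.adicCompletion K) (AlgebraicClosure (w.adicCompletion K)) (adicCompletionMap (K := ℚ) K v₀ w y))
  (hfixU : ∀ h : absoluteGaloisGroup (v₀.adicCompletion ℚ), resGalOfEmb ι h ∈ galRange (K := ℚ) K → ∀ y : w.adicCompletion K,
    (show AlgebraicClosure (v₀.adicCompletion ℚ) ≃ₐ[v₀.adicCompletion ℚ] AlgebraicClosure (v₀.adicCompletion ℚ) from h)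
        (ι₂.symm (algebraMap (w.adicCompletion K) (AlgebraicClosure (w.adicCompletion K)) y)) =
      ι₂.symm (algebraMap (w.adicCompletion K) (AlgebraicClosure (w.adicCompletion K)) y))
  (W : WeierstrassCurve ℚ) (ε : ℤˣ) (n : ℕ) [((galRange (K := ℚ) K).subgroupOf (κ.layerSubgroup n)).Normal]

include hκ hv₀ hcompat hι₂ hfixU in
/-- ★★★★★ **D3-W at `p`, end to end.** `K/ℚ` quadratic, `p` odd, `κ` the cyclotomic `ℤ_p`-extension, `v₀ ∋ p`, `w` a place of `K`; the local square
`(ι, ι₂)` at `ι' = closureEmb K_w` with `ι₂|_{ℚ_{v₀}} = (ℚ_{v₀} → K_w)` and the fixing hypothesis for `galRange K` (`…E1LocalSquareInert`); `c ∈ Λ_n` with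
`res_ι c ∉ galRange K`; `e : ↥((galRange K).subgroupOf Γ_{ℚ_n}) →ₜ* ↥(Γ_{ℚ_n} ∩ galRange K)` over `Γ_ℚ`. For a `K`-side class `y ∈ H¹(Γ_{K_n}, E_K[p^∞])`
(`Γ_{K_n} = κ_K.layerSubgroup n`) in Kobayashi's signed Kummer condition `E^ε(K_n·K_w)` at `closureEmb K_w`:
`res_{ℚ_∞/ℚ_n} (cor (e^* (subgroupH1Iso (res_= y)))) ∈ AcSigned.condAbove W p κ v₀ (.sgn ε)`.
[cite: Kobayashi2003, Def. 1.1] [cite: BDKim2013, Def. 3.1 and Def. 3.3 (p. 193)] [cite: SerreGaloisCohomology1997, I §2.4, II §1.1] -/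
theorem resOfLe_corH1_mem_condAbove_sgn
    (e : ((galRange (K := ℚ) K).subgroupOf (κ.layerSubgroup n)) →ₜ* (κ.layerSubgroup n ⊓ galRange (K := ℚ) K : Subgroup (absoluteGaloisGroup ℚ)))
    (he : ∀ x : (galRange (K := ℚ) K).subgroupOf (κ.layerSubgroup n),
      ((e x : (κ.layerSubgroup n ⊓ galRange (K := ℚ) K : Subgroup (absoluteGaloisGroup ℚ))) : absoluteGaloisGroup ℚ) =
        ((x : κ.layerSubgroup n) : absoluteGaloisGroup ℚ))
    {c : absoluteGaloisGroup (v₀.adicCompletion ℚ)} (hc : c ∈ localSubgroupOfEmb (κ.layerSubgroup n) ι) (hcU : resGalOfEmb ι c ∉ galRange (K := ℚ) K)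
    (hN : IsOpen (((galRange (K := ℚ) K).subgroupOf (κ.layerSubgroup n) : Subgroup (κ.layerSubgroup n)) : Set (κ.layerSubgroup n)))
    (hM : ∀ m : W.geomPrimaryTorsion p, Continuous fun g : κ.layerSubgroup n ↦ g • m)
    (hopen : IsOpen ((κ.layerSubgroup n ⊓ galRange (K := ℚ) K : Subgroup (absoluteGaloisGroup ℚ)) : Set (absoluteGaloisGroup ℚ)))
    (y : (W.baseChange K).subgroupH1 p ((κ.restrictOfFinrankEqTwo hp2 K hK2).layerSubgroup n))
    (hy : y ∈ Kobayashi2003.localKummerOverOfEmb (W.baseChange K) p ((κ.restrictOfFinrankEqTwo hp2 K hK2).layerSubgroup n)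
      (closureEmb (K := K) (w.adicCompletion K))
      (Kobayashi2003.signedLocalPointsOfEmb (κ.restrictOfFinrankEqTwo hp2 K hK2) (closureEmb (K := K) (w.adicCompletion K)) (W.baseChange K) ε n)) :
    W.resOfLe p (κ.kerSubgroup_le_layerSubgroup n)
        (corH1 hN hM (xor_mem_subgroupOf_of_index_two (κ.layerSubgroup n) (galRange (K := ℚ) K) ι (index_galRange_eq_two K hK2) hc hcU)
          (resH1Hom e (AddMonoidHom.id (W.geomPrimaryTorsion p))
            (smul_eq_smul_of_coe_eq W p (κ.layerSubgroup n) (galRange (K := ℚ) K) e he)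
            (subgroupH1Iso K W p (inf_le_right : κ.layerSubgroup n ⊓ galRange (K := ℚ) K ≤ galRange (K := ℚ) K)
              ((W.baseChange K).resOfLe p (le_of_eq (comapResGal_layerSubgroup_inf_galRange hp2 κ K hK2 n)) y)))) ∈
      AcSigned.condAbove W p κ v₀ (.sgn ε) := by
  letI : Algebra (v₀.adicCompletion ℚ) (w.adicCompletion K) := (adicCompletionMap (K := ℚ) K v₀ w).toAlgebra
  have hx := (EtaLayer.subgroupH1Iso_mem_localKummerOverOfEmb_iff (L := K) (ι := ι) (ι₂ := ι₂) (ι' := closureEmb (K := K) (w.adicCompletion K))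
    (hcompat := hcompat) (f := adicCompletionMap (K := ℚ) K v₀ w) (hf := hι₂) (hfixL := hfixU) (W := W) (p := p)
    (hU := (inf_le_right : κ.layerSubgroup n ⊓ galRange (K := ℚ) K ≤ galRange (K := ℚ) K))
    (A' := Kobayashi2003.signedLocalPointsOfEmb (κ.restrictOfFinrankEqTwo hp2 K hK2) (closureEmb (K := K) (w.adicCompletion K))
      (W.baseChange K) ε n)
    (x := (W.baseChange K).resOfLe p (le_of_eq (comapResGal_layerSubgroup_inf_galRange hp2 κ K hK2 n)) y)).2
    (resOfLe_mem_localKummerOverOfEmb_comapResGal hp2 κ K hK2 (closureEmb (K := K) (w.adicCompletion K)) W n _ hy)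
  have hz := corH1_resH1Hom_mem_localKummerOverOfEmb_signed_of_mem hp2 κ K hK2 ι ι₂ (closureEmb (K := K) (w.adicCompletion K)) hcompat
    hι₂ hfixU (index_galRange_eq_two K hK2) W ε n e he hc hcU hN hM hopen _ hx
  exact resOfLe_mem_condAbove_sgn_of_mem_layer W κ hκ v₀ hv₀ ε ι n hz

include hκ hv₀ hcompat hι₂ hfixU in
/-- ★★★★★ **Layer-`n` handshake with `…RttCharRoadE1TopPackaging.resOfLe_mem_acSignedSelmer_of_layer`** (its `hsgn` at `v₀`): under the hypotheses
of `resOfLe_corH1_mem_condAbove_sgn`, EVERY conjugate `conj_σ`, `σ ∈ Γ_ℚ`, of `η = cor (e^* (subgroupH1Iso (res_= y))) ∈ H¹(Γ_{ℚ_n}, E[p^∞])` lies in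
`localKummerOverOfEmb W p (κ.layerSubgroup n) (closureEmb ℚ_{v₀}) (signedLocalPoints κ ℚ_{v₀} W ε n)` — the condition at the package's `ι` (★★★★ of
`…E1LocalCoresClass`), moved to `closureEmb` by one conjugation (`exists_algHom_eq_comp`, `EtaLayer.conjH1_mem_localKummerOverOfEmb_iff`,
`EtaLayer.signedLocalPointsOfEmb_comp`), then to all conjugates (`SignedLowerOffTwo.PTDeep.conjH1_mem_localKummerOverOfEmb_signed`, `κ` cyclotomic).
[cite: Kobayashi2003, Def. 1.1, §2 p. 4] [cite: SerreGaloisCohomology1997, I §2.5, II §1.1] -/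
theorem conjH1_corH1_mem_localKummerOverOfEmb_signed_closureEmb
    (e : ((galRange (K := ℚ) K).subgroupOf (κ.layerSubgroup n)) →ₜ* (κ.layerSubgroup n ⊓ galRange (K := ℚ) K : Subgroup (absoluteGaloisGroup ℚ)))
    (he : ∀ x : (galRange (K := ℚ) K).subgroupOf (κ.layerSubgroup n),
      ((e x : (κ.layerSubgroup n ⊓ galRange (K := ℚ) K : Subgroup (absoluteGaloisGroup ℚ))) : absoluteGaloisGroup ℚ) =
        ((x : κ.layerSubgroup n) : absoluteGaloisGroup ℚ))
    {c : absoluteGaloisGroup (v₀.adicCompletion ℚ)} (hc : c ∈ localSubgroupOfEmb (κ.layerSubgroup n) ι) (hcU : resGalOfEmb ι c ∉ galRange (K := ℚ) K)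
    (hN : IsOpen (((galRange (K := ℚ) K).subgroupOf (κ.layerSubgroup n) : Subgroup (κ.layerSubgroup n)) : Set (κ.layerSubgroup n)))
    (hM : ∀ m : W.geomPrimaryTorsion p, Continuous fun g : κ.layerSubgroup n ↦ g • m)
    (hopen : IsOpen ((κ.layerSubgroup n ⊓ galRange (K := ℚ) K : Subgroup (absoluteGaloisGroup ℚ)) : Set (absoluteGaloisGroup ℚ)))
    (y : (W.baseChange K).subgroupH1 p ((κ.restrictOfFinrankEqTwo hp2 K hK2).layerSubgroup n))
    (hy : y ∈ Kobayashi2003.localKummerOverOfEmb (W.baseChange K) p ((κ.restrictOfFinrankEqTwo hp2 K hK2).layerSubgroup n)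
      (closureEmb (K := K) (w.adicCompletion K))
      (Kobayashi2003.signedLocalPointsOfEmb (κ.restrictOfFinrankEqTwo hp2 K hK2) (closureEmb (K := K) (w.adicCompletion K)) (W.baseChange K) ε n))
    (σ : absoluteGaloisGroup ℚ) :
    W.conjH1 p (κ.layerSubgroup n) σ
        (corH1 hN hM (xor_mem_subgroupOf_of_index_two (κ.layerSubgroup n) (galRange (K := ℚ) K) ι (index_galRange_eq_two K hK2) hc hcU)
          (resH1Hom e (AddMonoidHom.id (W.geomPrimaryTorsion p))
            (smul_eq_smul_of_coe_eq W p (κ.layerSubgroup n) (galRange (K := ℚ) K) e he)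
            (subgroupH1Iso K W p (inf_le_right : κ.layerSubgroup n ⊓ galRange (K := ℚ) K ≤ galRange (K := ℚ) K)
              ((W.baseChange K).resOfLe p (le_of_eq (comapResGal_layerSubgroup_inf_galRange hp2 κ K hK2 n)) y)))) ∈
      Kobayashi2003.localKummerOverOfEmb W p (κ.layerSubgroup n) (closureEmb (K := ℚ) (v₀.adicCompletion ℚ))
        (Kobayashi2003.signedLocalPoints κ (v₀.adicCompletion ℚ) W ε n) := by
  letI : Algebra (v₀.adicCompletion ℚ) (w.adicCompletion K) := (adicCompletionMap (K := ℚ) K v₀ w).toAlgebra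
  have hx := (EtaLayer.subgroupH1Iso_mem_localKummerOverOfEmb_iff (L := K) (ι := ι) (ι₂ := ι₂) (ι' := closureEmb (K := K) (w.adicCompletion K))
    (hcompat := hcompat) (f := adicCompletionMap (K := ℚ) K v₀ w) (hf := hι₂) (hfixL := hfixU) (W := W) (p := p)
    (hU := (inf_le_right : κ.layerSubgroup n ⊓ galRange (K := ℚ) K ≤ galRange (K := ℚ) K))
    (A' := Kobayashi2003.signedLocalPointsOfEmb (κ.restrictOfFinrankEqTwo hp2 K hK2) (closureEmb (K := K) (w.adicCompletion K))
      (W.baseChange K) ε n)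
    (x := (W.baseChange K).resOfLe p (le_of_eq (comapResGal_layerSubgroup_inf_galRange hp2 κ K hK2 n)) y)).2
    (resOfLe_mem_localKummerOverOfEmb_comapResGal hp2 κ K hK2 (closureEmb (K := K) (w.adicCompletion K)) W n _ hy)
  have hz := corH1_resH1Hom_mem_localKummerOverOfEmb_signed_of_mem hp2 κ K hK2 ι ι₂ (closureEmb (K := K) (w.adicCompletion K)) hcompat
    hι₂ hfixU (index_galRange_eq_two K hK2) W ε n e he hc hcU hN hM hopen _ hx
  -- move to `closureEmb ℚ_{v₀}` by one conjugation, then to every conjugate (one orbit at the layer, `κ` cyclotomic)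
  obtain ⟨τ, hτ⟩ := exists_algHom_eq_comp (closureEmb (K := ℚ) (v₀.adicCompletion ℚ)) ι
  have e1 : σ = (σ * (show absoluteGaloisGroup ℚ from τ)⁻¹) * (show absoluteGaloisGroup ℚ from τ) := by rw [inv_mul_cancel_right]
  rw [e1, W.conjH1_mul_holds p (κ.layerSubgroup n), AddMonoidHom.comp_apply]
  refine SignedLowerOffTwo.PTDeep.conjH1_mem_localKummerOverOfEmb_signed W κ v₀ hκ hv₀ ε n ?_ _
  delta Kobayashi2003.signedLocalPoints
  rw [EtaLayer.conjH1_mem_localKummerOverOfEmb_iff,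
    ← EtaLayer.signedLocalPointsOfEmb_comp κ (closureEmb (K := ℚ) (v₀.adicCompletion ℚ)) τ ε n, ← hτ]
  exact hz

end Glue

end Summit.BirchSwinnertonDyer.BirchSwinnertonDyer.Theorems.SmallImageCharSignedSelmer

end
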